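import Summits.PneNP.PneNP.Theorems.ConvexRankGatesConvexGateBlindExactLiftingTrianglePlaneLocalAdd

/-!
# Triangle instance — plane-local factorisations: lines plus ONE direction never solve the additive coupling condition

Support file for crux `ConvexGateBlind` (stmt-PneNP-10680), open stub `stub_exactLifting` (prover seat 3, session 15);
sequel of `…TrianglePlaneLocalAdd` (`AddSolves`) and `…TrianglePlaneLocalLines` (additive atoms are useless).
Two elementary rigidity facts of `AddSolves` for NON-NEGATIVE dictionaries:
* `addSolves_interaction_pos` — at the singleton pair `({a},{d})` the combination `X₀ = Σ c₀ h` has strictly positive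
  `2 × 2` interaction `X₀(a,d) + X₀(a',d') − X₀(a,d') − X₀(a',d) > 0` on every rectangle through `(a,d)` (domination of
  `X₀` by `α a` on row `a` and by `β d` on column `d`, plus `X₁(a,d) ≥ 0`, `X₀(a',d') ≥ 0`).
* `triangle_planeLocal_rankOne` (registered stub) — if `3 ≤ t` and every atom is an additive matrix plus a multiple of ONE
  fixed matrix `w` (`H i = f_i ⊕ g_i + c_i • w`), then `AddSolves H` fails: interactions of `X₀` are `(Σ c₀ c) · I(w)`, so
  the sign of `Σ c₀ c` at the pair `({a},{d})` fixes the sign of `I(w; a,a'; d,d')`, and antisymmetry of `I(w)` in the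
  two rows makes these signs alternate between any two of three rows — impossible.
Consequence (memo `PLANELOCAL-seat3.md` §7(g)): a solving dictionary spans at least `dim(span ∩ Add) + 2 ≥ 2t` dimensions;
at `t = 3` the bound `7` is attained by a cone but not by a 7-atom dictionary.  Nothing here is cited; everything is elementary.
-/

set_option linter.dupNamespace false -- `Summit.PneNP.PneNP.…`: summit = sub-problem (D-0017)

namespace Summit.PneNP.PneNP.Theorems.XorDoor.TriLine

open Finset

variable {t : ℕ}

/-- Three reals whose pairwise "sign relations" through three mediators are all opposite cannot exist:
the sign pattern forced on `L₁, L₂, L₃` by an antisymmetric interaction is contradictory. -/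
theorem sign_chain_absurd {L₁ L₂ L₃ I₁₂ I₂₃ I₁₃ : ℝ} (h₁ : 0 < L₁ * I₁₂) (h₂ : L₂ * I₁₂ < 0) (h₃ : 0 < L₂ * I₂₃)
    (h₄ : L₃ * I₂₃ < 0) (h₅ : 0 < L₁ * I₁₃) (h₆ : L₃ * I₁₃ < 0) : False := by
  have p₁ : L₁ * I₁₂ * (L₂ * I₁₂) < 0 := mul_neg_of_pos_of_neg h₁ h₂
  have p₂ : L₂ * I₂₃ * (L₃ * I₂₃) < 0 := mul_neg_of_pos_of_neg h₃ h₄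
  have p₃ : L₁ * I₁₃ * (L₃ * I₁₃) < 0 := mul_neg_of_pos_of_neg h₅ h₆
  have q : 0 < L₁ * I₁₂ * (L₂ * I₁₂) * (L₂ * I₂₃ * (L₃ * I₂₃)) := mul_pos_of_neg_of_neg p₁ p₂
  have r : L₁ * I₁₂ * (L₂ * I₁₂) * (L₂ * I₂₃ * (L₃ * I₂₃)) * (L₁ * I₁₃ * (L₃ * I₁₃)) < 0 :=
    mul_neg_of_pos_of_neg q p₃
  have e : L₁ * I₁₂ * (L₂ * I₁₂) * (L₂ * I₂₃ * (L₃ * I₂₃)) * (L₁ * I₁₃ * (L₃ * I₁₃)) =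
      (L₁ * L₂ * L₃ * I₁₂ * I₂₃ * I₁₃) ^ 2 := by ring
  rw [e] at r
  exact absurd r (not_lt.mpr (sq_nonneg _))

/-- **Positive interactions at a singleton pair.**  For a non-negative dictionary satisfying `AddSolves`, the pair
`({a},{d})` (admissible as soon as some `a₀ ≠ a` and `d₀ ≠ d` exist) yields a non-negative combination `X₀ = Σ c₀ h` whose
`2 × 2` interaction on every rectangle `(a,a') × (d,d')` is strictly positive. -/
theorem addSolves_interaction_pos {ι : Type} [Fintype ι] {H : ι → Fin t → Fin t → ℝ} (hH : ∀ i a d, 0 ≤ H i a d)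
    (hA : AddSolves H) (a a₀ : Fin t) (d d₀ : Fin t) (ha₀ : a₀ ≠ a) (hd₀ : d₀ ≠ d) :
    ∃ c₀ : ι → ℝ, (∀ i, 0 ≤ c₀ i) ∧ ∀ a' d', a' ≠ a → d' ≠ d →
      0 < (∑ i, c₀ i * H i a d) + (∑ i, c₀ i * H i a' d') - (∑ i, c₀ i * H i a d') - (∑ i, c₀ i * H i a' d) := by
  classical
  obtain ⟨c₀, c₁, α, β, hc₀, hc₁, hadd, -, -, -, -, hdomB, hdomC⟩ :=
    hA (fun x => decide (x = a)) (fun y => decide (y = d)) ⟨a, by simp⟩ ⟨a₀, by simp [ha₀]⟩ ⟨d, by simp⟩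
      ⟨d₀, by simp [hd₀]⟩
  refine ⟨c₀, hc₀, fun a' d' ha' hd' => ?_⟩
  have h1 : ∑ i, c₀ i * H i a d' < α a := hdomB a d' (by simp) (by simp [hd'])
  have h2 : ∑ i, c₀ i * H i a' d < β d := hdomC a' d (by simp [ha']) (by simp)
  have h3 : 0 ≤ ∑ i, c₁ i * H i a d := sum_nonneg fun i _ => mul_nonneg (hc₁ i) (hH i a d)
  have h4 : 0 ≤ ∑ i, c₀ i * H i a' d' := sum_nonneg fun i _ => mul_nonneg (hc₀ i) (hH i a' d')
  have h5 := hadd a d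
  linarith

/-- Interactions of a combination of atoms of the form `f ⊕ g + c • w` are `(Σ c₀ c) · I(w)`. -/
theorem interaction_of_rankOne {ι : Type} [Fintype ι] {H : ι → Fin t → Fin t → ℝ} {w : Fin t → Fin t → ℝ}
    {f g : ι → Fin t → ℝ} {c : ι → ℝ} (hfg : ∀ i a d, H i a d = f i a + g i d + c i * w a d) (c₀ : ι → ℝ)
    (a a' d d' : Fin t) :
    (∑ i, c₀ i * H i a d) + (∑ i, c₀ i * H i a' d') - (∑ i, c₀ i * H i a d') - (∑ i, c₀ i * H i a' d) =
      (∑ i, c₀ i * c i) * (w a d + w a' d' - w a d' - w a' d) := by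
  have key : ∀ x y, ∑ i, c₀ i * H i x y =
      (∑ i, c₀ i * f i x) + (∑ i, c₀ i * g i y) + (∑ i, c₀ i * c i) * w x y := by
    intro x y
    rw [sum_mul, ← sum_add_distrib, ← sum_add_distrib]
    exact sum_congr rfl fun i _ => by rw [hfg i x y]; ring
  rw [key a d, key a' d', key a d', key a' d]
  ring

/-- Registered form (stub `triangle_planeLocal_rankOne` of stmt-PneNP-10680): for `3 ≤ t`, a non-negative dictionary all of
whose atoms lie in `Add ⊕ ⟨w⟩` (lines plus one direction) never satisfies the additive coupling condition. -/
theorem triangle_planeLocal_rankOne : ∀ {t : ℕ} {ι : Type} [Fintype ι] {H : ι → Fin t → Fin t → ℝ}, 3 ≤ t → (∀ i a d, 0 ≤ H i a d) → ∀ (w : Fin t → Fin t → ℝ), (∀ i, ∃ (f g : Fin t → ℝ) (c : ℝ), ∀ a d, H i a d = f a + g d + c * w a d) → ¬ AddSolves H := by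
  intro t ι _ H ht hH w hspan hA
  choose f g c hfgc using hspan
  have hfg : ∀ i a d, H i a d = f i a + g i d + c i * w a d := fun i a d => hfgc i a d
  -- three rows and two columns
  obtain ⟨a₁, a₂, a₃, d, d', h12, h13, h23, hd⟩ :
      ∃ a₁ a₂ a₃ d d' : Fin t, a₂ ≠ a₁ ∧ a₃ ≠ a₁ ∧ a₃ ≠ a₂ ∧ d' ≠ d :=
    ⟨⟨0, by omega⟩, ⟨1, by omega⟩, ⟨2, by omega⟩, ⟨0, by omega⟩, ⟨1, by omega⟩,
      by simp [Fin.ext_iff], by simp [Fin.ext_iff], by simp [Fin.ext_iff], by simp [Fin.ext_iff]⟩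
  -- pair ({a₁},{d})
  obtain ⟨e₁, -, he₁⟩ := addSolves_interaction_pos hH hA a₁ a₂ d d' h12 hd
  have k₁₂ := he₁ a₂ d' h12 hd
  have k₁₃ := he₁ a₃ d' h13 hd
  rw [interaction_of_rankOne hfg] at k₁₂ k₁₃
  -- pair ({a₂},{d})
  obtain ⟨e₂, -, he₂⟩ := addSolves_interaction_pos hH hA a₂ a₁ d d' h12.symm hd
  have k₂₁ := he₂ a₁ d' h12.symm hd
  have k₂₃ := he₂ a₃ d' h23 hd
  rw [interaction_of_rankOne hfg] at k₂₁ k₂₃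
  -- pair ({a₃},{d})
  obtain ⟨e₃, -, he₃⟩ := addSolves_interaction_pos hH hA a₃ a₁ d d' h13.symm hd
  have k₃₁ := he₃ a₁ d' h13.symm hd
  have k₃₂ := he₃ a₂ d' h23.symm hd
  rw [interaction_of_rankOne hfg] at k₃₁ k₃₂
  -- antisymmetry of the interaction in the two rows
  have x₂₁ : (∑ i, e₂ i * c i) * (w a₁ d + w a₂ d' - w a₁ d' - w a₂ d) < 0 := by nlinarith [k₂₁]
  have x₃₂ : (∑ i, e₃ i * c i) * (w a₂ d + w a₃ d' - w a₂ d' - w a₃ d) < 0 := by nlinarith [k₃₂]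
  have x₃₁ : (∑ i, e₃ i * c i) * (w a₁ d + w a₃ d' - w a₁ d' - w a₃ d) < 0 := by nlinarith [k₃₁]
  exact sign_chain_absurd k₁₂ x₂₁ k₂₃ x₃₂ k₁₃ x₃₁

end Summit.PneNP.PneNP.Theorems.XorDoor.TriLine
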